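import Summits.QuantumFields.YangMills.Theorems.AllWindowsColdBoxBoxHighLineGaussianChartWickIntegrable
import Summits.QuantumFields.YangMills.Theorems.AllWindowsColdBoxBoxHighLineSpectralFloorTools

/-!
# T-S5.11a «colour copies» — the Gaussian `exp(−β Σ_c v_cᵀ L v_c) dv` on `ι × o → ℝ` (precision `L ⊗ₖ 1`), its propagator between colour legs,
# and the colour-summed covariance of squares `= 2·|o|·S(u,w)²`

Step (2) of the XL comparison stub S5 (LINE-19 ⟨stmt-QuantumFields-24004⟩/⟨24335⟩ `stub_landauSecondOrder`; planner ym-idea-2 g18's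
`STUB-PLAN-S5-STEP2.md` §1–§2: the reference Gaussian `μ₀ = ⊗_{c=1}^{3} N(0,(2β·hodgeQ)⁻¹)` = «LEAD's chart Gaussian `exp(−β vᵀPv) dv`, `P = hodgeQ ⊗ 1₃`»,
and T-S5.11 «main term `β²Cov₀ = 3·2·((2β)⁻¹·β)²·K_L²`»).  This file supplies, for ANY positive-definite `L : Matrix ι ι ℝ` and ANY finite colour type `o`,
in the letters of ✓4w″ (`…GaussianChartWickFintype`) and w4 g27's ✓`SpectralFloorTools` (`kronecker_one`, `blockDiagonal_const_mulVec`, `dotProduct_prod_eq_sum`):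

* `posDef_kronecker_one` — `L.PosDef → (L ⊗ₖ (1 : Matrix o o ℝ)).PosDef`; `det_kronecker_one` — `det (L ⊗ₖ 1) = (det L)^{|o|}`;
  `kronecker_one_inv` — `(L ⊗ₖ 1)⁻¹ = L⁻¹ ⊗ₖ 1` (for `det L ≠ 0`);
* colour legs `x_a := fun p => if p.2 = a then u p.1 else 0`: `colourLeg_dotProduct` (`x_a ⬝ᵥ v = u ⬝ᵥ v(·,a)`) and the PROPAGATOR
  `colourLeg_dotProduct_inv_mulVec_colourLeg` (`x_a ⬝ᵥ (L ⊗ₖ 1)⁻¹ y_b = if a = b then u ⬝ᵥ L⁻¹ w else 0`), `sum_sq_colour_propagator`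
  (`Σ_{a,b} (…)² = |o| · (u ⬝ᵥ L⁻¹ w)²`);
* **`integral_colourSumSq_mul_colourSumSq`** — with `Z = √(π/β)^{|ι×o|}/√det(L ⊗ₖ 1)` and `K = u ⬝ᵥ L⁻¹ w`:
  `Z·∫(Σ_a (u⬝v_a)²)(Σ_b (w⬝v_b)²)e^{−β v(L⊗1)v} dv = (∫Σ_a(u⬝v_a)²e)(∫Σ_b(w⬝v_b)²e) + Z²·2·|o|·((2β)⁻¹K)²`
  — i.e. `Cov_{μ₀}(Σ_a (u⬝v_a)², Σ_b (w⬝v_b)²) = 2·|o|·((2β)⁻¹ K)²`; at `L = hodgeQ H`, `o = Fin 3`, `u = landauCoeff H p`, `w = landauCoeff H q` and ✓S2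
  (`DirProjKernelHodgeForm`: `K = boxDirProjKernel H p q = K_D`) this is T-S5.11's `β²Cov₀(c₀^{(2)},c_T^{(2)}) = (3/2)·K_D²` up to the builder's normalisation of `c^{(2)}`.

Tree (✓GaussianChartWickIntegrable, ✓SpectralFloorTools) + Mathlib; no definitions.  HONEST LABEL: infrastructure for step (2) of the XL stub S5 of a critic-PASSed
DRAFT line; T-S5.4J, S5, U5, ⟨24004⟩ ⟨24335⟩ ⟨24336⟩ remain OPEN; no summit is proved; the Yang–Mills mass gap is NOT proved by this file.
Seat ym-line-sfw-p2 g77 (LEAD, cell ym-idea-1).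
-/

set_option autoImplicit false

noncomputable section

open MeasureTheory Matrix Finset
open scoped Kronecker

namespace Summit.QuantumFields.YangMills.Theorems.AllWindowsColdBoxBoxHighLine

namespace GaussianChartWick

variable {ι : Type*} [Fintype ι] [DecidableEq ι] {o : Type*} [Fintype o] [DecidableEq o]

/-! ## The colour-diagonal precision `L ⊗ₖ 1` -/

omit [DecidableEq ι] in
/-- The quadratic form of `L ⊗ₖ 1` is the colour sum of the forms of `L`. -/
theorem dotProduct_kronecker_one_mulVec (L : Matrix ι ι ℝ) (v w : ι × o → ℝ) :
    v ⬝ᵥ ((L ⊗ₖ (1 : Matrix o o ℝ)) *ᵥ w) = ∑ c : o, (fun y => v (y, c)) ⬝ᵥ (L *ᵥ fun y => w (y, c)) := by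
  rw [Matrix.kronecker_one, SpectralFloor.dotProduct_prod_eq_sum]
  refine Finset.sum_congr rfl fun c _ => ?_
  congr 1
  funext y
  rw [SpectralFloor.blockDiagonal_const_mulVec]

omit [DecidableEq ι] in
/-- **`L ⊗ₖ 1` is positive definite when `L` is.** -/
theorem posDef_kronecker_one (L : Matrix ι ι ℝ) (hL : L.PosDef) : (L ⊗ₖ (1 : Matrix o o ℝ)).PosDef := by
  refine Matrix.PosDef.of_dotProduct_mulVec_pos ?_ fun x hx => ?_
  · have h := hL.isHermitian
    rw [Matrix.IsHermitian, Matrix.conjTranspose_kronecker, h, Matrix.conjTranspose_one]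
  · rw [star_trivial, dotProduct_kronecker_one_mulVec]
    -- some colour slice of `x` is nonzero
    have hex : ∃ c : o, (fun y => x (y, c)) ≠ 0 := by
      by_contra hall
      push Not at hall
      apply hx
      funext p
      have := congrFun (hall p.2) p.1
      simpa using this
    obtain ⟨c₀, hc₀⟩ := hex
    have hpos : 0 < (fun y => x (y, c₀)) ⬝ᵥ (L *ᵥ fun y => x (y, c₀)) := by
      have := hL.dotProduct_mulVec_pos hc₀
      rwa [star_trivial] at this
    have hnn : ∀ c : o, 0 ≤ (fun y => x (y, c)) ⬝ᵥ (L *ᵥ fun y => x (y, c)) := fun c => by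
      have := hL.posSemidef.dotProduct_mulVec_nonneg (fun y => x (y, c))
      rwa [star_trivial] at this
    exact lt_of_lt_of_le hpos (Finset.single_le_sum (fun c _ => hnn c) (Finset.mem_univ c₀))

/-- `det (L ⊗ₖ 1) = (det L)^{|o|}`. -/
theorem det_kronecker_one (L : Matrix ι ι ℝ) : (L ⊗ₖ (1 : Matrix o o ℝ)).det = L.det ^ Fintype.card o := by
  rw [Matrix.det_kronecker, Matrix.det_one, one_pow, mul_one]

/-- `(L ⊗ₖ 1)⁻¹ = L⁻¹ ⊗ₖ 1` for invertible `L`. -/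
theorem kronecker_one_inv (L : Matrix ι ι ℝ) (hL : L.det ≠ 0) :
    (L ⊗ₖ (1 : Matrix o o ℝ))⁻¹ = L⁻¹ ⊗ₖ (1 : Matrix o o ℝ) := by
  have hLu : IsUnit L.det := isUnit_iff_ne_zero.mpr hL
  refine Matrix.inv_eq_right_inv ?_
  rw [← Matrix.mul_kronecker_mul, Matrix.mul_nonsing_inv _ hLu, Matrix.mul_one, Matrix.one_kronecker_one]

/-! ## Colour legs and their propagator -/

omit [DecidableEq ι] in
/-- A colour leg reads one colour slice: `x_a ⬝ᵥ v = u ⬝ᵥ v(·,a)` for `x_a = fun p => if p.2 = a then u p.1 else 0`. -/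
theorem colourLeg_dotProduct (u : ι → ℝ) (a : o) (v : ι × o → ℝ) :
    (fun p : ι × o => if p.2 = a then u p.1 else 0) ⬝ᵥ v = u ⬝ᵥ fun y => v (y, a) := by
  rw [SpectralFloor.dotProduct_prod_eq_sum]
  simp only [dotProduct]
  rw [Finset.sum_eq_single a]
  · simp
  · intro c _ hc
    simp [hc]
  · intro h; exact absurd (Finset.mem_univ a) h

omit [DecidableEq ι] in
/-- `(L⁻¹ ⊗ₖ 1)` applied to a colour leg stays in that colour. -/
theorem kronecker_one_mulVec_colourLeg (M : Matrix ι ι ℝ) (w : ι → ℝ) (b : o) (p : ι × o) :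
    ((M ⊗ₖ (1 : Matrix o o ℝ)) *ᵥ fun q : ι × o => if q.2 = b then w q.1 else 0) p =
      if p.2 = b then (M *ᵥ w) p.1 else 0 := by
  rw [Matrix.kronecker_one, SpectralFloor.blockDiagonal_const_mulVec]
  by_cases h : p.2 = b
  · simp [h]
  · simp [h, Matrix.mulVec, dotProduct]

/-- **The propagator between colour legs**: `x_a ⬝ᵥ (L ⊗ₖ 1)⁻¹ y_b = δ_{ab} · u ⬝ᵥ L⁻¹ w`. -/
theorem colourLeg_dotProduct_inv_mulVec_colourLeg (L : Matrix ι ι ℝ) (hL : L.det ≠ 0) (u w : ι → ℝ) (a b : o) :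
    (fun p : ι × o => if p.2 = a then u p.1 else 0) ⬝ᵥ
        ((L ⊗ₖ (1 : Matrix o o ℝ))⁻¹ *ᵥ fun q : ι × o => if q.2 = b then w q.1 else 0) =
      if a = b then u ⬝ᵥ (L⁻¹ *ᵥ w) else 0 := by
  rw [kronecker_one_inv L hL, colourLeg_dotProduct]
  have h : (fun y => ((L⁻¹ ⊗ₖ (1 : Matrix o o ℝ)) *ᵥ fun q : ι × o => if q.2 = b then w q.1 else 0) (y, a)) =
      fun y => if a = b then (L⁻¹ *ᵥ w) y else 0 := by
    funext y
    rw [kronecker_one_mulVec_colourLeg]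
  rw [h]
  by_cases hab : a = b
  · simp [hab]
  · simp [hab]

/-- **Colour sum of squared propagators**: `Σ_{a,b} (x_a ⬝ᵥ P⁻¹ y_b)² = |o| · (u ⬝ᵥ L⁻¹ w)²` (only the diagonal `a = b` survives). -/
theorem sum_sq_colour_propagator (L : Matrix ι ι ℝ) (hL : L.det ≠ 0) (u w : ι → ℝ) (r : ℝ) :
    ∑ a : o, ∑ b : o, (r * ((fun p : ι × o => if p.2 = a then u p.1 else 0) ⬝ᵥ
        ((L ⊗ₖ (1 : Matrix o o ℝ))⁻¹ *ᵥ fun q : ι × o => if q.2 = b then w q.1 else 0))) ^ 2 =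
      Fintype.card o * (r * (u ⬝ᵥ (L⁻¹ *ᵥ w))) ^ 2 := by
  simp_rw [colourLeg_dotProduct_inv_mulVec_colourLeg L hL, mul_ite, mul_zero, ite_pow, zero_pow two_ne_zero,
    Finset.sum_ite_eq, Finset.mem_univ, if_true, Finset.sum_const, Finset.card_univ, nsmul_eq_mul]

/-! ## The colour-summed covariance of squares against `exp(−β v (L ⊗ₖ 1) v) dv` -/

/-- **T-S5.11a (Gaussian part of the S5 main term).**  For a positive-definite `L : Matrix ι ι ℝ`, a finite colour type `o`, `β > 0`, `u w : ι → ℝ`,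
with `Z = √(π/β)^{|ι×o|}/√det(L ⊗ₖ 1)` and the colour legs `x_a ⬝ᵥ v = u ⬝ᵥ v(·,a)`, `y_b ⬝ᵥ v = w ⬝ᵥ v(·,b)`:
`Z·∫(Σ_a (x_a⬝v)²)(Σ_b (y_b⬝v)²)e^{−βv(L⊗1)v} = (∫Σ_a(x_a⬝v)²e^{…})(∫Σ_b(y_b⬝v)²e^{…}) + Z²·(2·|o|·((2β)⁻¹·u⬝L⁻¹w)²)`. -/
theorem integral_colourSumSq_mul_colourSumSq (L : Matrix ι ι ℝ) (hL : L.PosDef) {β : ℝ} (hβ : 0 < β) (u w : ι → ℝ) :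
    Real.sqrt (Real.pi / β) ^ Fintype.card (ι × o) / Real.sqrt (L ⊗ₖ (1 : Matrix o o ℝ)).det *
        ∫ v : ι × o → ℝ, (∑ a : o, ((fun p : ι × o => if p.2 = a then u p.1 else 0) ⬝ᵥ v) ^ 2) *
          (∑ b : o, ((fun p : ι × o => if p.2 = b then w p.1 else 0) ⬝ᵥ v) ^ 2) *
            Real.exp (-(β * (v ⬝ᵥ (L ⊗ₖ (1 : Matrix o o ℝ)) *ᵥ v))) =
      (∫ v : ι × o → ℝ, (∑ a : o, ((fun p : ι × o => if p.2 = a then u p.1 else 0) ⬝ᵥ v) ^ 2) *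
          Real.exp (-(β * (v ⬝ᵥ (L ⊗ₖ (1 : Matrix o o ℝ)) *ᵥ v)))) *
        (∫ v : ι × o → ℝ, (∑ b : o, ((fun p : ι × o => if p.2 = b then w p.1 else 0) ⬝ᵥ v) ^ 2) *
          Real.exp (-(β * (v ⬝ᵥ (L ⊗ₖ (1 : Matrix o o ℝ)) *ᵥ v)))) +
      (Real.sqrt (Real.pi / β) ^ Fintype.card (ι × o) / Real.sqrt (L ⊗ₖ (1 : Matrix o o ℝ)).det) ^ 2 *
        (2 * (Fintype.card o * ((2 * β)⁻¹ * (u ⬝ᵥ (L⁻¹ *ᵥ w))) ^ 2)) := by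
  have hP : (L ⊗ₖ (1 : Matrix o o ℝ)).PosDef := posDef_kronecker_one L hL
  have hLdet : L.det ≠ 0 := hL.det_pos.ne'
  rw [integral_sumSq_mul_sumSq_mul_exp_quadForm' _ hP hβ Finset.univ Finset.univ
    (fun a : o => fun p : ι × o => if p.2 = a then u p.1 else 0) (fun b : o => fun p : ι × o => if p.2 = b then w p.1 else 0),
    sum_sq_colour_propagator L hLdet u w]

end GaussianChartWick

end Summit.QuantumFields.YangMills.Theorems.AllWindowsColdBoxBoxHighLine

end
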